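import Literature.NumberTheory.LFunctions.WeilLineSupSampling
import Literature.NumberTheory.LFunctions.WeilWindowSuzukiContinuityProofs
import HarnessLib

/-!
# T64 — the comb: window tests whose transform vanishes on a lattice

For a test `H` and `τ > 0` the COMB `g(x) = H(x + τ) - H(x - τ)` has
`ĝ(1/2 + it) = -2i sin(tτ) Ĥ(1/2 + it)` (`weilMellin_comb`), so `ĝ` vanishes at every point
`1/2 + i kπ/τ`, `k ∈ ℤ` (`weilMellin_comb_lattice_eq_zero`); its support grows by `τ` on each
side (`tsupport_comb_subset`) and it is nonzero as soon as `H` is (`comb_ne_zero`: a periodic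
compactly supported function vanishes).  Consequently (`exists_isWeilTest_vanishing_on_lattice`):

  for every `D > 0` and every `a > π / D` there is a nonzero Weil test `g` supported in
  `[-a, a]` with `ĝ(1/2 + i k D) = 0` for all `k ∈ ℤ`.

A window-`a` transform can therefore vanish on EVERY lattice of spacing `D > π/a`.
Use (s19, sharpest §2k): the analytic core of the model configurations — a multiset of
"zeros" clustered at the points of such a lattice is invisible to the window-`a` Weil form,
so zero-counting information valid only at scales `≥ π/a` cannot by itself certify any lower
bound for the window ground energy; the companion positive statement is the leak inequality
T63 (`SoloInformedTimeLimitLeak`).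
-/

open Complex Set Filter MeasureTheory Literature.NumberTheory.LFunctions
open scoped Real Topology

namespace Summit.RiemannHypothesis.RiemannHypothesis.Theorems

variable {H : ℝ → ℂ} {b : ℝ}

/-- The comb `x ↦ H(x + τ) - H(x - τ)` as a difference of translates. -/
theorem comb_eq_weilTranslate_sub (H : ℝ → ℂ) (τ : ℝ) :
    (fun x ↦ H (x + τ) - H (x - τ)) = weilTranslate H (-τ) - weilTranslate H τ := by
  funext x
  simp [weilTranslate]

/-- The comb of a test function is a test function. -/
theorem isWeilTest_comb (hH : IsWeilTest H) (τ : ℝ) :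
    IsWeilTest fun x ↦ H (x + τ) - H (x - τ) := by
  rw [comb_eq_weilTranslate_sub]
  exact ⟨(hH.weilTranslate (-τ)).1.sub (hH.weilTranslate τ).1,
    (hH.weilTranslate (-τ)).2.sub (hH.weilTranslate τ).2⟩

/-- Transform of the comb on the critical line: `ĝ(1/2 + it) = -2i sin(tτ) Ĥ(1/2 + it)`. -/
theorem weilMellin_comb (hH : IsWeilTest H) (τ t : ℝ) :
    weilMellin (fun x ↦ H (x + τ) - H (x - τ)) (1 / 2 + t * I) =
      -(2 * I * Real.sin (t * τ)) * weilMellin H (1 / 2 + t * I) := by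
  rw [comb_eq_weilTranslate_sub, weilMellin_sub (hH.weilTranslate (-τ)).1.continuous
    (hH.weilTranslate (-τ)).2 (hH.weilTranslate τ).1.continuous (hH.weilTranslate τ).2,
    weilMellin_weilTranslate, weilMellin_weilTranslate]
  have hA : cexp ((1 / 2 + (t : ℂ) * I - 1 / 2) * ((-τ : ℝ) : ℂ)) =
      Complex.cos (t * τ) - Complex.sin (t * τ) * I := by
    rw [show (1 / 2 + (t : ℂ) * I - 1 / 2) * ((-τ : ℝ) : ℂ) = (-(t * τ : ℂ)) * I by
      push_cast; ring, Complex.exp_mul_I, Complex.cos_neg, Complex.sin_neg]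
    ring
  have hB : cexp ((1 / 2 + (t : ℂ) * I - 1 / 2) * (τ : ℂ)) =
      Complex.cos (t * τ) + Complex.sin (t * τ) * I := by
    rw [show (1 / 2 + (t : ℂ) * I - 1 / 2) * (τ : ℂ) = (t * τ : ℂ) * I by ring,
      Complex.exp_mul_I]
  rw [hA, hB, Complex.ofReal_sin]
  push_cast
  ring

/-- The comb's transform vanishes on the lattice `1/2 + i (π/τ) ℤ`. -/
theorem weilMellin_comb_lattice_eq_zero (hH : IsWeilTest H) {τ : ℝ} (hτ : τ ≠ 0) (k : ℤ) :
    weilMellin (fun x ↦ H (x + τ) - H (x - τ)) (1 / 2 + ((k * π / τ : ℝ) : ℂ) * I) = 0 := by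
  rw [weilMellin_comb hH, div_mul_cancel₀ _ hτ, Real.sin_int_mul_pi]
  simp

/-- The comb's support: `supp H ⊆ [-b, b]` and `τ ≥ 0` give `supp g ⊆ [-(b + τ), b + τ]`. -/
theorem tsupport_comb_subset (hHb : tsupport H ⊆ Icc (-b) b) {τ : ℝ} (hτ : 0 ≤ τ) :
    tsupport (fun x ↦ H (x + τ) - H (x - τ)) ⊆ Icc (-(b + τ)) (b + τ) := by
  refine closure_minimal (fun x hx ↦ ?_) isClosed_Icc
  by_contra hxI
  apply hx
  have h0 : ∀ y, y ∉ Icc (-b) b → H y = 0 := fun y hy ↦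
    image_eq_zero_of_notMem_tsupport fun h ↦ hy (hHb h)
  simp only [mem_Icc, not_and_or, not_le] at hxI
  show H (x + τ) - H (x - τ) = 0
  rw [h0 (x + τ), h0 (x - τ), sub_zero]
  · intro h
    rcases hxI with h' | h'
    · linarith [h.1]
    · linarith [h.2]
  · intro h
    rcases hxI with h' | h'
    · linarith [h.1]
    · linarith [h.2]

/-- The comb of a nonzero compactly supported `H` is nonzero (`τ > 0`): if `H(x + τ) = H(x - τ)`
for all `x` then `H` is `2τ`-periodic, and a periodic compactly supported function vanishes. -/
theorem comb_ne_zero (hHb : tsupport H ⊆ Icc (-b) b) (hH0 : H ≠ 0) {τ : ℝ} (hτ : 0 < τ) :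
    (fun x ↦ H (x + τ) - H (x - τ)) ≠ 0 := by
  intro hg
  apply hH0
  have hper : ∀ x, H (x + τ) = H (x - τ) := fun x ↦ sub_eq_zero.1 (congr_fun hg x)
  funext x₀
  have hiter : ∀ n : ℕ, H (x₀ + 2 * n * τ) = H x₀ := by
    intro n
    induction n with
    | zero => simp
    | succ n ih =>
        have h1 := hper (x₀ + (2 * n + 1) * τ)
        rw [show x₀ + (2 * n + 1) * τ - τ = x₀ + 2 * n * τ by ring] at h1
        rw [show x₀ + 2 * ((n + 1 : ℕ) : ℝ) * τ = x₀ + (2 * n + 1) * τ + τ by push_cast; ring,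
          h1, ih]
  obtain ⟨n, hn⟩ : ∃ n : ℕ, b < x₀ + 2 * n * τ := by
    obtain ⟨n, hn⟩ := exists_nat_gt ((b - x₀) / (2 * τ))
    refine ⟨n, ?_⟩
    rw [div_lt_iff₀ (by positivity)] at hn
    linarith
  rw [← hiter n]
  exact image_eq_zero_of_notMem_tsupport fun h ↦ by linarith [(hHb h).2]

/-- **The comb test.** For every `D > 0` and every `a > π / D` there is a nonzero Weil test `g`
supported in `[-a, a]` whose transform vanishes at `1/2 + i k D` for every integer `k`:
a window-`a` transform can vanish on every lattice of spacing `D > π / a`. -/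
theorem exists_isWeilTest_vanishing_on_lattice {D a : ℝ} (hD : 0 < D) (ha : π / D < a) :
    ∃ g : ℝ → ℂ, IsWeilTest g ∧ tsupport g ⊆ Icc (-a) a ∧ g ≠ 0 ∧
      ∀ k : ℤ, weilMellin g (1 / 2 + ((k * D : ℝ) : ℂ) * I) = 0 := by
  obtain ⟨τ, hτ⟩ : ∃ τ : ℝ, τ = π / D := ⟨_, rfl⟩
  have hτ0 : 0 < τ := by
    rw [hτ]
    positivity
  have hτa : 0 < a - τ := by
    rw [hτ]
    linarith
  obtain ⟨H, hH, hHb, hH0⟩ := exists_isWeilTest_bump_weilMellin_half_ne_zero hτa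
  have hHne : H ≠ 0 := by
    rintro rfl
    apply hH0
    simp [weilMellin]
  refine ⟨fun x ↦ H (x + τ) - H (x - τ), isWeilTest_comb hH τ, ?_, comb_ne_zero hHb hHne hτ0,
    fun k ↦ ?_⟩
  · have h1 := tsupport_comb_subset hHb hτ0.le
    rwa [show a - τ + τ = a by ring] at h1
  · have hk : (k * D : ℝ) = k * π / τ := by
      rw [hτ]
      field_simp
    rw [hk]
    exact weilMellin_comb_lattice_eq_zero hH hτ0.ne' k

end Summit.RiemannHypothesis.RiemannHypothesis.Theorems
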